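import Mathlib.Algebra.MvPolynomial.PDeriv
import Mathlib.LinearAlgebra.Matrix.Determinant.Basic
import Mathlib.LinearAlgebra.Matrix.Notation
import Mathlib.Data.Rat.Defs
import Mathlib.Tactic
import HarnessLib

/-!
# Kernel evaluation of Klein-type covariants of a ternary form at a rational point (a TOOL)

Cell `b2b-bsdres` (run/shared/lean/b2b/bsd-rank1-residual/), supersingular family, prover A = unit `b2b-bsdres-x10b`
(gen 25).  Summits-side TOOL file (our own bookkeeping, no mathematics claimed): it lets `decide +kernel` evaluate, at a
rational point `P = (x, y, z)`, polynomial expressions built from a ternary form `𝓠 ∈ ℚ[x,y,z]` by PARTIAL DERIVATIVES and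
DETERMINANTS — the Hessian `H(𝓠) = s·|∂²𝓠/∂xᵢ∂xⱼ|`, its gradient and second partials, a bordered Hessian
`c₄ = t·|∂²𝓠/∂xᵢ∂xⱼ, ∂H/∂xᵢ; ∂H/∂xⱼ, 0|`, its gradient, and a Jacobian `c₆ = r·|∇𝓠; ∇H; ∇c₄|` (the shape of Klein's
covariants of the Klein quartic, T. Fisher, LMS J. Comput. Math. 17 (2014) §3.2) — WITHOUT expanding any covariant
symbolically: every derivative of a determinant is rewritten (Leibniz/Jacobi) as a sum of determinants whose entries are
higher partials of `𝓠` and of `H`, and those of `H` again as determinants in partials of `𝓠`; so only the partial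
derivatives of `𝓠` itself (an explicit sparse polynomial) are ever formed, and everything else is arithmetic in `ℚ`.

## Contents
* `TernaryPoly.Poly` — computable sparse polynomials `Σ c·x^i y^j z^k` (`List` of monomials over `ℚ`), with `toMv`
  (semantics in `MvPolynomial (Fin 3) ℚ`), `deriv` (↔ `MvPolynomial.pderiv`, `toMv_deriv`) and `eval`
  (↔ `MvPolynomial.eval`, `eval_toMv`) — PROVED.
* `det3v`, `det4v` (explicit `3 × 3`, `4 × 4` determinants over any commutative ring) with `Matrix.det` comparison lemmas
  `det_fin_three_eq_det3v`, `det_fin_four_eq_det4v`, and their images under ring homomorphisms — PROVED.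
* the generic covariant expressions `hVal`, `hDer`, `hDer2`, `c4Val`, `c4Der`, `c6Val` (over any commutative ring) and the
  CALCULUS IDENTITIES `pderiv_hVal`, `pderiv_hDer`, `pderiv_c4Val` (partial derivative of each determinant expression = the
  next expression in the higher partials) — PROVED by `simp` + `ring`; and their images under `MvPolynomial.eval`.
Nothing here is specific to `n = 7`; the consumer (`X7SevenCongruenceCertificates.lean`) instantiates `𝓠` with Fisher's twisted
Klein quartic.  THEOREMS + computable DEFINITIONS only; no named fact; nothing booked.

HONEST FRAMING (verbatim in every file of the cell): the goal of the cell is to DELETE the COMBINATION-SHAPED residual classes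
of the Birch–Swinnerton-Dyer formula for ALL analytic-rank `≤ 1` elliptic curves over `ℚ` — "full BSD formula for every rank
`≤ 1` curve in class `C`" assembled STRICTLY from published theorems — so that the rank-`≤ 1` remainder becomes exactly the
CONSTRUCTION-SHAPED classes, which are TYPED (missing-input `Prop`s), NOT attempted.  This is not "finishing BSD".

References: T. Fisher, LMS J. Comput. Math. 17 (2014) 536–564, §3.2 [Fisher2014SevenElevenCongruent] (the shape of the
covariants); C. G. J. Jacobi's formula `∂ det M = Σ_c det(M with column c differentiated)` [folklore].
-/

set_option autoImplicit false

open MvPolynomial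

namespace Summit.BirchSwinnertonDyer.Rank1Residual.Supersingular

namespace TernaryPoly

/-! ### Computable sparse ternary polynomials -/

/-- A monomial `c · x^i · y^j · z^k` with `c ∈ ℚ`. [folklore] -/
structure Mono where
  /-- exponent of `x` -/
  i : ℕ
  /-- exponent of `y` -/
  j : ℕ
  /-- exponent of `z` -/
  k : ℕ
  /-- coefficient -/
  c : ℚ
deriving DecidableEq

/-- A sparse ternary polynomial: a list of monomials (repetitions allowed; the value is the sum). [folklore] -/
abbrev Poly := List Mono

/-- The exponent vector of a monomial as a finitely supported function on `Fin 3`. [folklore] -/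
noncomputable def Mono.exps (m : Mono) : Fin 3 →₀ ℕ :=
  Finsupp.single 0 m.i + Finsupp.single 1 m.j + Finsupp.single 2 m.k

/-- Semantics of a monomial in `MvPolynomial (Fin 3) ℚ`. [folklore] -/
noncomputable def Mono.toMv (m : Mono) : MvPolynomial (Fin 3) ℚ :=
  monomial m.exps m.c

/-- Semantics of a sparse polynomial: the sum of its monomials. [folklore] -/
noncomputable def toMv (p : Poly) : MvPolynomial (Fin 3) ℚ :=
  (p.map Mono.toMv).sum

/-- Partial derivative of a monomial with respect to the `v`-th variable (`v = 0, 1, 2` ↔ `x, y, z`):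
`∂(c x^i y^j z^k)/∂x = (c·i) x^(i-1) y^j z^k` etc. (for exponent `0` the coefficient is `0`). [folklore] -/
def Mono.deriv (v : Fin 3) (m : Mono) : Mono :=
  match v with
  | 0 => ⟨m.i - 1, m.j, m.k, m.c * m.i⟩
  | 1 => ⟨m.i, m.j - 1, m.k, m.c * m.j⟩
  | 2 => ⟨m.i, m.j, m.k - 1, m.c * m.k⟩

/-- Partial derivative of a sparse polynomial (termwise). [folklore] -/
def deriv (v : Fin 3) (p : Poly) : Poly :=
  p.map (Mono.deriv v)

/-- Evaluation of a sparse polynomial at `(x, y, z) ∈ ℚ³`. [folklore] -/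
def eval (x y z : ℚ) (p : Poly) : ℚ :=
  (p.map fun m => m.c * x ^ m.i * y ^ m.j * z ^ m.k).sum

/-- The `x`-exponent. [folklore] -/
theorem Mono.exps_apply_zero (m : Mono) : m.exps 0 = m.i := by
  simp [Mono.exps]

/-- The `y`-exponent. [folklore] -/
theorem Mono.exps_apply_one (m : Mono) : m.exps 1 = m.j := by
  simp [Mono.exps]

/-- The `z`-exponent. [folklore] -/
theorem Mono.exps_apply_two (m : Mono) : m.exps 2 = m.k := by
  simp [Mono.exps]

/-- `toMv` of a concatenation is the sum. [folklore] -/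
theorem toMv_append (p q : Poly) : toMv (p ++ q) = toMv p + toMv q := by
  simp [toMv, List.map_append, List.sum_append]

/-- `toMv` of a cons. [folklore] -/
theorem toMv_cons (m : Mono) (p : Poly) : toMv (m :: p) = m.toMv + toMv p := by
  simp [toMv]

/-- Semantics of `Mono.deriv`: it is `MvPolynomial.pderiv` on the monomial. [folklore] -/
theorem Mono.toMv_deriv (v : Fin 3) (m : Mono) : (m.deriv v).toMv = pderiv v m.toMv := by
  simp only [Mono.toMv]
  rw [pderiv_monomial]
  have hexp : (m.deriv v).exps = m.exps - Finsupp.single v 1 := by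
    ext w
    fin_cases v <;> fin_cases w <;> simp [Mono.exps, Mono.deriv]
  have hcoef : (m.deriv v).c = m.c * (m.exps v : ℚ) := by
    fin_cases v <;> simp [Mono.exps, Mono.deriv]
  rw [hexp, hcoef]

/-- Semantics of `deriv`: `toMv (deriv v p) = ∂(toMv p)/∂x_v`. [folklore] -/
theorem toMv_deriv (v : Fin 3) (p : Poly) : toMv (deriv v p) = pderiv v (toMv p) := by
  induction p with
  | nil => simp [toMv, deriv]
  | cons m t ih =>
    rw [deriv, List.map_cons, toMv_cons, toMv_cons, map_add, ← Mono.toMv_deriv, ← ih, deriv]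

/-- Semantics of a monomial under evaluation. [folklore] -/
theorem Mono.eval_toMv (x y z : ℚ) (m : Mono) :
    MvPolynomial.eval ![x, y, z] m.toMv = m.c * x ^ m.i * y ^ m.j * z ^ m.k := by
  rw [Mono.toMv, eval_monomial, Mono.exps]
  have h0 : ∀ a : Fin 3, (![x, y, z] a) ^ (0 : ℕ) = 1 := fun a => pow_zero _
  have hadd : ∀ (a : Fin 3) (b₁ b₂ : ℕ), (![x, y, z] a) ^ (b₁ + b₂) = (![x, y, z] a) ^ b₁ * (![x, y, z] a) ^ b₂ :=
    fun a b₁ b₂ => pow_add _ _ _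
  rw [Finsupp.prod_add_index' h0 hadd, Finsupp.prod_add_index' h0 hadd,
    Finsupp.prod_single_index (h := fun n e => (![x, y, z] n) ^ e) (h0 0),
    Finsupp.prod_single_index (h := fun n e => (![x, y, z] n) ^ e) (h0 1),
    Finsupp.prod_single_index (h := fun n e => (![x, y, z] n) ^ e) (h0 2)]
  simp only [Matrix.cons_val_zero, Matrix.cons_val_one, Matrix.cons_val]
  ring

/-- Semantics of `eval`: `MvPolynomial.eval (x,y,z) (toMv p) = eval x y z p`. [folklore] -/
theorem eval_toMv (x y z : ℚ) (p : Poly) : MvPolynomial.eval ![x, y, z] (toMv p) = eval x y z p := by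
  induction p with
  | nil => simp [toMv, eval]
  | cons m t ih =>
    rw [toMv_cons, map_add, ih, Mono.eval_toMv]
    simp [eval]

end TernaryPoly

/-! ### Explicit small determinants -/

section Det

variable {R : Type*} [CommRing R]

/-- The `3 × 3` determinant `|a b c; d e f; g h i|`, expanded along the first row. [folklore] -/
def det3v (a b c d e f g h i : R) : R :=
  a * (e * i - f * h) - b * (d * i - f * g) + c * (d * h - e * g)

/-- The `4 × 4` determinant of `(aᵢⱼ)`, expanded along the first row into `3 × 3` minors. [folklore] -/
def det4v (a00 a01 a02 a03 a10 a11 a12 a13 a20 a21 a22 a23 a30 a31 a32 a33 : R) : R :=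
  a00 * det3v a11 a12 a13 a21 a22 a23 a31 a32 a33 - a01 * det3v a10 a12 a13 a20 a22 a23 a30 a32 a33
    + a02 * det3v a10 a11 a13 a20 a21 a23 a30 a31 a33 - a03 * det3v a10 a11 a12 a20 a21 a22 a30 a31 a32

/-- `Matrix.det` of a `3 × 3` matrix is `det3v` of its entries. [folklore] -/
theorem det_fin_three_eq_det3v (A : Matrix (Fin 3) (Fin 3) R) :
    A.det = det3v (A 0 0) (A 0 1) (A 0 2) (A 1 0) (A 1 1) (A 1 2) (A 2 0) (A 2 1) (A 2 2) := by
  rw [Matrix.det_fin_three, det3v]; ring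

/-- `Matrix.det` of a `4 × 4` matrix is `det4v` of its entries. [folklore] -/
theorem det_fin_four_eq_det4v (A : Matrix (Fin 4) (Fin 4) R) :
    A.det = det4v (A 0 0) (A 0 1) (A 0 2) (A 0 3) (A 1 0) (A 1 1) (A 1 2) (A 1 3)
      (A 2 0) (A 2 1) (A 2 2) (A 2 3) (A 3 0) (A 3 1) (A 3 2) (A 3 3) := by
  rw [Matrix.det_succ_row_zero]
  simp only [Fin.sum_univ_four, Matrix.det_fin_three, Matrix.submatrix_apply, det4v, det3v]
  simp [Fin.succAbove, Fin.succ, Fin.castSucc, Fin.lt_def]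
  ring

/-- A ring homomorphism commutes with `det3v`. [folklore] -/
theorem map_det3v {S : Type*} [CommRing S] (f : R →+* S) (a b c d e f' g h i : R) :
    f (det3v a b c d e f' g h i) = det3v (f a) (f b) (f c) (f d) (f e) (f f') (f g) (f h) (f i) := by
  simp only [det3v, map_add, map_sub, map_mul]

/-- A ring homomorphism commutes with `det4v`. [folklore] -/
theorem map_det4v {S : Type*} [CommRing S] (f : R →+* S)
    (a00 a01 a02 a03 a10 a11 a12 a13 a20 a21 a22 a23 a30 a31 a32 a33 : R) :
    f (det4v a00 a01 a02 a03 a10 a11 a12 a13 a20 a21 a22 a23 a30 a31 a32 a33) =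
      det4v (f a00) (f a01) (f a02) (f a03) (f a10) (f a11) (f a12) (f a13) (f a20) (f a21) (f a22) (f a23)
        (f a30) (f a31) (f a32) (f a33) := by
  simp only [det4v, map_add, map_sub, map_mul, map_det3v]

/-! ### The covariant expressions in terms of partial derivatives (generic), and their calculus -/

/-- `H = s · |q₂ᵢⱼ|` — the Hessian-type determinant from the second partials `q₂ i j`. [folklore] -/
def hVal (s : R) (q₂ : Fin 3 → Fin 3 → R) : R :=
  s * det3v (q₂ 0 0) (q₂ 0 1) (q₂ 0 2) (q₂ 1 0) (q₂ 1 1) (q₂ 1 2) (q₂ 2 0) (q₂ 2 1) (q₂ 2 2)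

/-- `∂H/∂x_a = s · Σ_c |… column c replaced by the third partials q₃ a · c …|` (Jacobi). [folklore] -/
def hDer (s : R) (q₂ : Fin 3 → Fin 3 → R) (q₃ : Fin 3 → Fin 3 → Fin 3 → R) (a : Fin 3) : R :=
  s * (det3v (q₃ a 0 0) (q₂ 0 1) (q₂ 0 2) (q₃ a 1 0) (q₂ 1 1) (q₂ 1 2) (q₃ a 2 0) (q₂ 2 1) (q₂ 2 2)
    + det3v (q₂ 0 0) (q₃ a 0 1) (q₂ 0 2) (q₂ 1 0) (q₃ a 1 1) (q₂ 1 2) (q₂ 2 0) (q₃ a 2 1) (q₂ 2 2)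
    + det3v (q₂ 0 0) (q₂ 0 1) (q₃ a 0 2) (q₂ 1 0) (q₂ 1 1) (q₃ a 1 2) (q₂ 2 0) (q₂ 2 1) (q₃ a 2 2))

/-- `∂²H/∂x_b∂x_a` as a sum of nine `3 × 3` determinants in the second, third and fourth partials
(differentiate `hDer` once more, column by column). [folklore] -/
def hDer2 (s : R) (q₂ : Fin 3 → Fin 3 → R) (q₃ : Fin 3 → Fin 3 → Fin 3 → R)
    (q₄ : Fin 3 → Fin 3 → Fin 3 → Fin 3 → R) (a b : Fin 3) : R :=
  s * (
    -- column 0 differentiated by a, then columns 0 / 1 / 2 by b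
      det3v (q₄ b a 0 0) (q₂ 0 1) (q₂ 0 2) (q₄ b a 1 0) (q₂ 1 1) (q₂ 1 2) (q₄ b a 2 0) (q₂ 2 1) (q₂ 2 2)
    + det3v (q₃ a 0 0) (q₃ b 0 1) (q₂ 0 2) (q₃ a 1 0) (q₃ b 1 1) (q₂ 1 2) (q₃ a 2 0) (q₃ b 2 1) (q₂ 2 2)
    + det3v (q₃ a 0 0) (q₂ 0 1) (q₃ b 0 2) (q₃ a 1 0) (q₂ 1 1) (q₃ b 1 2) (q₃ a 2 0) (q₂ 2 1) (q₃ b 2 2)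
    -- column 1 differentiated by a, then columns 0 / 1 / 2 by b
    + det3v (q₃ b 0 0) (q₃ a 0 1) (q₂ 0 2) (q₃ b 1 0) (q₃ a 1 1) (q₂ 1 2) (q₃ b 2 0) (q₃ a 2 1) (q₂ 2 2)
    + det3v (q₂ 0 0) (q₄ b a 0 1) (q₂ 0 2) (q₂ 1 0) (q₄ b a 1 1) (q₂ 1 2) (q₂ 2 0) (q₄ b a 2 1) (q₂ 2 2)
    + det3v (q₂ 0 0) (q₃ a 0 1) (q₃ b 0 2) (q₂ 1 0) (q₃ a 1 1) (q₃ b 1 2) (q₂ 2 0) (q₃ a 2 1) (q₃ b 2 2)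
    -- column 2 differentiated by a, then columns 0 / 1 / 2 by b
    + det3v (q₃ b 0 0) (q₂ 0 1) (q₃ a 0 2) (q₃ b 1 0) (q₂ 1 1) (q₃ a 1 2) (q₃ b 2 0) (q₂ 2 1) (q₃ a 2 2)
    + det3v (q₂ 0 0) (q₃ b 0 1) (q₃ a 0 2) (q₂ 1 0) (q₃ b 1 1) (q₃ a 1 2) (q₂ 2 0) (q₃ b 2 1) (q₃ a 2 2)
    + det3v (q₂ 0 0) (q₂ 0 1) (q₄ b a 0 2) (q₂ 1 0) (q₂ 1 1) (q₄ b a 1 2) (q₂ 2 0) (q₂ 2 1) (q₄ b a 2 2))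

/-- `c₄ = t · |q₂ᵢⱼ, hᵢ; hⱼ, 0|` — the bordered Hessian from the second partials and the gradient `h₁` of `H`. [folklore] -/
def c4Val (t : R) (q₂ : Fin 3 → Fin 3 → R) (h₁ : Fin 3 → R) : R :=
  t * det4v (q₂ 0 0) (q₂ 0 1) (q₂ 0 2) (h₁ 0) (q₂ 1 0) (q₂ 1 1) (q₂ 1 2) (h₁ 1)
    (q₂ 2 0) (q₂ 2 1) (q₂ 2 2) (h₁ 2) (h₁ 0) (h₁ 1) (h₁ 2) 0

/-- `∂c₄/∂x_a = t · Σ_{c=0..3} |… column c differentiated …|` (Jacobi), in the second/third partials of the form and the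
first/second partials `h₁`, `h₂` of `H`. [folklore] -/
def c4Der (t : R) (q₂ : Fin 3 → Fin 3 → R) (q₃ : Fin 3 → Fin 3 → Fin 3 → R) (h₁ : Fin 3 → R)
    (h₂ : Fin 3 → Fin 3 → R) (a : Fin 3) : R :=
  t * (det4v (q₃ a 0 0) (q₂ 0 1) (q₂ 0 2) (h₁ 0) (q₃ a 1 0) (q₂ 1 1) (q₂ 1 2) (h₁ 1)
          (q₃ a 2 0) (q₂ 2 1) (q₂ 2 2) (h₁ 2) (h₂ a 0) (h₁ 1) (h₁ 2) 0
      + det4v (q₂ 0 0) (q₃ a 0 1) (q₂ 0 2) (h₁ 0) (q₂ 1 0) (q₃ a 1 1) (q₂ 1 2) (h₁ 1)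
          (q₂ 2 0) (q₃ a 2 1) (q₂ 2 2) (h₁ 2) (h₁ 0) (h₂ a 1) (h₁ 2) 0
      + det4v (q₂ 0 0) (q₂ 0 1) (q₃ a 0 2) (h₁ 0) (q₂ 1 0) (q₂ 1 1) (q₃ a 1 2) (h₁ 1)
          (q₂ 2 0) (q₂ 2 1) (q₃ a 2 2) (h₁ 2) (h₁ 0) (h₁ 1) (h₂ a 2) 0
      + det4v (q₂ 0 0) (q₂ 0 1) (q₂ 0 2) (h₂ a 0) (q₂ 1 0) (q₂ 1 1) (q₂ 1 2) (h₂ a 1)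
          (q₂ 2 0) (q₂ 2 1) (q₂ 2 2) (h₂ a 2) (h₁ 0) (h₁ 1) (h₁ 2) 0)

/-- `c₆ = r · |∇𝓠; ∇H; ∇c₄|`. [folklore] -/
def c6Val (r : R) (q₁ : Fin 3 → R) (h₁ : Fin 3 → R) (k₁ : Fin 3 → R) : R :=
  r * det3v (q₁ 0) (q₁ 1) (q₁ 2) (h₁ 0) (h₁ 1) (h₁ 2) (k₁ 0) (k₁ 1) (k₁ 2)

/-- Ring homomorphisms commute with `hVal`. [folklore] -/
theorem map_hVal {S : Type*} [CommRing S] (f : R →+* S) (s : R) (q₂ : Fin 3 → Fin 3 → R) :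
    f (hVal s q₂) = hVal (f s) (fun i j => f (q₂ i j)) := by
  simp only [hVal, map_mul, map_det3v]

/-- Ring homomorphisms commute with `hDer`. [folklore] -/
theorem map_hDer {S : Type*} [CommRing S] (f : R →+* S) (s : R) (q₂ : Fin 3 → Fin 3 → R)
    (q₃ : Fin 3 → Fin 3 → Fin 3 → R) (a : Fin 3) :
    f (hDer s q₂ q₃ a) = hDer (f s) (fun i j => f (q₂ i j)) (fun i j k => f (q₃ i j k)) a := by
  simp only [hDer, map_mul, map_add, map_det3v]

/-- Ring homomorphisms commute with `hDer2`. [folklore] -/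
theorem map_hDer2 {S : Type*} [CommRing S] (f : R →+* S) (s : R) (q₂ : Fin 3 → Fin 3 → R)
    (q₃ : Fin 3 → Fin 3 → Fin 3 → R) (q₄ : Fin 3 → Fin 3 → Fin 3 → Fin 3 → R) (a b : Fin 3) :
    f (hDer2 s q₂ q₃ q₄ a b) =
      hDer2 (f s) (fun i j => f (q₂ i j)) (fun i j k => f (q₃ i j k)) (fun i j k l => f (q₄ i j k l)) a b := by
  simp only [hDer2, map_mul, map_add, map_det3v]

/-- Ring homomorphisms commute with `c4Val`. [folklore] -/
theorem map_c4Val {S : Type*} [CommRing S] (f : R →+* S) (t : R) (q₂ : Fin 3 → Fin 3 → R) (h₁ : Fin 3 → R) :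
    f (c4Val t q₂ h₁) = c4Val (f t) (fun i j => f (q₂ i j)) (fun i => f (h₁ i)) := by
  simp only [c4Val, map_mul, map_det4v, map_zero]

/-- Ring homomorphisms commute with `c4Der`. [folklore] -/
theorem map_c4Der {S : Type*} [CommRing S] (f : R →+* S) (t : R) (q₂ : Fin 3 → Fin 3 → R)
    (q₃ : Fin 3 → Fin 3 → Fin 3 → R) (h₁ : Fin 3 → R) (h₂ : Fin 3 → Fin 3 → R) (a : Fin 3) :
    f (c4Der t q₂ q₃ h₁ h₂ a) =
      c4Der (f t) (fun i j => f (q₂ i j)) (fun i j k => f (q₃ i j k)) (fun i => f (h₁ i)) (fun i j => f (h₂ i j)) a := by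
  simp only [c4Der, map_mul, map_add, map_det4v, map_zero]

/-- Ring homomorphisms commute with `c6Val`. [folklore] -/
theorem map_c6Val {S : Type*} [CommRing S] (f : R →+* S) (r : R) (q₁ h₁ k₁ : Fin 3 → R) :
    f (c6Val r q₁ h₁ k₁) = c6Val (f r) (fun i => f (q₁ i)) (fun i => f (h₁ i)) (fun i => f (k₁ i)) := by
  simp only [c6Val, map_mul, map_det3v]

end Det

/-! ### The calculus identities in `MvPolynomial (Fin 3) ℚ` -/

section Calculus

variable (Q : MvPolynomial (Fin 3) ℚ)

/-- first partials of `Q` -/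
noncomputable abbrev d₁ (a : Fin 3) : MvPolynomial (Fin 3) ℚ := pderiv a Q
/-- second partials of `Q` -/
noncomputable abbrev d₂ (a b : Fin 3) : MvPolynomial (Fin 3) ℚ := pderiv a (pderiv b Q)
/-- third partials of `Q` -/
noncomputable abbrev d₃ (a b c : Fin 3) : MvPolynomial (Fin 3) ℚ := pderiv a (pderiv b (pderiv c Q))
/-- fourth partials of `Q` -/
noncomputable abbrev d₄ (a b c d : Fin 3) : MvPolynomial (Fin 3) ℚ :=
  pderiv a (pderiv b (pderiv c (pderiv d Q)))

/-- **Jacobi for `H`**: `∂(s·|Q_ij|)/∂x_a = hDer` in the third partials. [folklore] -/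
theorem pderiv_hVal (s : ℚ) (a : Fin 3) :
    pderiv a (hVal (C s) (d₂ Q)) = hDer (C s) (d₂ Q) (d₃ Q) a := by
  simp only [hVal, hDer, det3v, d₂, d₃, map_add, map_sub, pderiv_mul, pderiv_C]
  ring

/-- **Second derivatives of `H`**: `∂(hDer a)/∂x_b = hDer2 a b` in the partials up to order four. [folklore] -/
theorem pderiv_hDer (s : ℚ) (a b : Fin 3) :
    pderiv b (hDer (C s) (d₂ Q) (d₃ Q) a) = hDer2 (C s) (d₂ Q) (d₃ Q) (d₄ Q) a b := by
  simp only [hDer, hDer2, det3v, d₂, d₃, d₄, map_add, map_sub, pderiv_mul, pderiv_C]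
  ring

/-- **Jacobi for the bordered Hessian**: with `h₁ a = ∂H/∂x_a = hDer a` and `h₂ a b = hDer2 b a` (so that
`∂(h₁ b)/∂x_a = h₂ a b`), `∂(c4Val)/∂x_a = c4Der a`. [folklore] -/
theorem pderiv_c4Val (s t : ℚ) (a : Fin 3) :
    pderiv a (c4Val (C t) (d₂ Q) (fun i => hDer (C s) (d₂ Q) (d₃ Q) i)) =
      c4Der (C t) (d₂ Q) (d₃ Q) (fun i => hDer (C s) (d₂ Q) (d₃ Q) i)
        (fun i j => hDer2 (C s) (d₂ Q) (d₃ Q) (d₄ Q) j i) a := by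
  have hh : ∀ i, pderiv a (hDer (C s) (d₂ Q) (d₃ Q) i) = hDer2 (C s) (d₂ Q) (d₃ Q) (d₄ Q) i a :=
    fun i => pderiv_hDer Q s i a
  simp only [c4Val, c4Der, det4v, det3v, map_add, map_sub, pderiv_mul, map_zero, pderiv_C, hh, d₂, d₃]
  ring

end Calculus

end Summit.BirchSwinnertonDyer.Rank1Residual.Supersingular
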